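import Literature.NumberTheory.Automorphic.PairLFunctionMeromorphicContinuationNeConjLocalDataThinTranslate
import Literature.NumberTheory.Automorphic.SpreadPairDatumNeConj
import Literature.NumberTheory.Automorphic.PairTorusIntegrandFinArchFactor
import Literature.NumberTheory.Automorphic.PairTorusIntegrandTwoValued
import Literature.NumberTheory.Automorphic.UnitBoxFiniteArchSplitting
import Literature.NumberTheory.Automorphic.WhittakerShiftTorusOutside
import Literature.NumberTheory.Automorphic.FinWhittakerLevelNonvanishing
import Literature.NumberTheory.Automorphic.WhittakerArchFinFactorization
import Literature.NumberTheory.Automorphic.PairLFunctionNeConjLevelOneOfTestVector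
import Literature.NumberTheory.Automorphic.PairLFunctionNeConjLevelOneOfArchTranslate
import HarnessLib

/-!
# Mœglin–Waldspurger, Corollaire (i)(b), for ALL pairs, from the archimedean local theory

Topic `NumberTheory/Automorphic`; namespace `Literature.NumberTheory.Automorphic`. Proof file (theorems
only) for the named fact `MoeglinWaldspurger1989_partialPairL_entire_of_ne_conj`
(`PairLFunctionMeromorphicContinuation`): for unitary cuspidal `π`, `π'` of `GL_n(𝔸_K)`, `n ≥ 1`,
with `π ≇ π̃'`, the partial Rankin–Selberg `L`-function `L^S(s, π × π')` continues to an ENTIRE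
function (Mœglin–Waldspurger (1989), Appendice, Corollaire (i)(b); Jacquet–Piatetski-Shapiro–Shalika
(1983), Prop. 3.3 with (2.7); Cogdell (2004), §4.1–§4.2).

`PairLFunctionNeConjLevelOneOfArch(TestVector)` proved this for LEVEL-ONE pairs. This file proves it
for ALL pairs, every number field and every rank, modulo ONLY the archimedean test-vector statement
`HumphriesJo2024_archRankinSelberg_testVector` (Humphries–Jo (2024), Thm. 1.1 — the archimedean
local theory of Jacquet–Shalika, vendored as a named fact in `ArchRankinSelbergTestVector`):

* `exists_const_setIntegral_pair_thin_translate_eq` — the `S`-part of the unfolded global integral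
  of ONE spread pair datum `(T_sp e, T₁' e', thinTestFun Φ_∞ S m)` translated by the torus of
  Whittaker shifts is a NON-ZERO constant times the archimedean local integral
  `Ψ_∞(s; W_e, W̄'_{e'}, Φ_∞)`: the thin test function confines the torus integral to the unit box
  (`setIntegral_torusPairIntegrandC_thin_eq_unitBox_univ`), where the integrand is a two-valued
  finite factor times the archimedean factor (`torusPairIntegrandC_translate_thin_eq_finFactor_mul_archFactor`,
  `finFactor_eq_zero_or_eq_apply_one` — the support theorem of Jacquet–Piatetski-Shapiro–Shalika
  (2.7) at the places of `S`), which splits off by uniqueness of Haar measure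
  (`exists_const_setIntegral_unitBox_two_valued_mul_eq`);
* `exists_entire_eq_partialPairL_of_archPairLFactorData_allPairs` (**main**) — for every pair
  `π ≠ σ̄` with Satake families off a finite `S`, `L^S(s, π × σ)` agrees on `re s > 1` with an
  entire function, from the archimedean `L`-factor data in the consumed form of
  `PairLFunctionNeConjLevelOneOfArch` (realised globally by spread pair data,
  `exists_spreadPairDatum_neConj`, at a level supported on `S`, `CuspidalLevelSupportedIn`, with the
  finite Whittaker functional non-vanishing at the torus, `FinWhittakerLevelNonvanishing`) and the
  per-pair reduction `exists_entire_eq_partialPairL_of_localData_thin_translate`;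
* `MoeglinWaldspurger1989_partialPairL_entire_of_ne_conj_of_testVector` — the named fact in rank
  `n` over `K` from `HumphriesJo2024_archRankinSelberg_testVector n K`
  (`archPairLFactorData_of_testVector`).

## References

* C. Mœglin, J.-L. Waldspurger, *Le spectre résiduel de GL(n)*, Ann. Sci. ÉNS (4) 22 (1989),
  Appendice, Corollaire (i)(b), p. 667 [MoeglinWaldspurger1989].
* H. Jacquet, I. I. Piatetski-Shapiro, J. A. Shalika, *Rankin–Selberg convolutions*, Amer. J. Math.
  105 (1983), §2 (2.7), Prop. 3.3, (3.6) [JacquetPiatetskiShapiroShalika1983].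
* J. W. Cogdell, *Analytic theory of L-functions for GL_n*, in *An Introduction to the Langlands
  Program* (2004), §2.3 Thm. 2.2, §3.2, §4.1–§4.2 [CogdellAnalyticTheory2004].
* P. Humphries, Y. Jo, *Test vectors for archimedean period integrals*, Publ. Mat. 68 (2024),
  Thm. 1.1 [HumphriesJo2024].
-/

noncomputable section

open MeasureTheory Measure NumberField NumberField.mixedEmbedding IsDedekindDomain Set Filter WithZero
open Literature.NumberTheory.GaloisRepresentations (ideleGroup unitIdeles)
open Literature.NumberTheory.Automorphic.WhittakerSupport
open scoped MatrixGroups ENNReal NNReal Classical ComplexConjugate Topology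

namespace Literature.NumberTheory.Automorphic

-- the automorphic quotient carries the tree's Borel σ-algebra, not Mathlib's quotient σ-algebra
attribute [-instance] Quotient.instMeasurableSpace QuotientGroup.measurableSpace

/-! ### Finite Whittaker functions of the finite component -/

section FinWhittaker

variable {n : ℕ} {K : Type} [Field K] [NumberField K]
variable {μ : Measure (AdelicGroupData.gl n K).automorphicQuotient} [(AdelicGroupData.gl n K).IsAutomorphicMeasure μ]
variable {hcpt : isCompact_glFiniteIntegralLevel n K}
  {E : Type*} [NormedAddCommGroup E] [InnerProductSpace ℂ E]
  {τ : ContRepresentation ℂ (AutomorphyDatum.gl n K hcpt).arch.carrier E}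
  {W : ContRepresentation.ClosedSubrep ((AdelicGroupData.gl n K).rightRegular μ)}

/-- `(ι_v u)_f` is upper unitriangular for `u ∈ N_n(K_v)`. [folklore] -/
theorem sndHom_ofLocal_mem_upperUnitriangular (v : HeightOneSpectrum (𝓞 K)) {u : GL (Fin n) (v.adicCompletion K)}
    (hu : u ∈ upperUnitriangular (Fin n) (v.adicCompletion K)) :
    GLn.sndHom n K (GLn.ofLocal n K v u) ∈ upperUnitriangular (Fin n) (FiniteAdeleRing (𝓞 K) K) := by
  have h := ofLocal_mem_adelicUnipotent (K := K) hu
  rw [← GLn.ofFinite_sndHom_ofLocal] at h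
  rw [mem_upperUnitriangular_iff] at h ⊢
  refine ⟨fun i j hij => ?_, fun i => ?_⟩
  · have h1 := h.1 hij
    rw [GLn.coe_ofFinite_apply] at h1
    exact congrArg Prod.snd h1
  · have h1 := h.2 i
    rw [GLn.coe_ofFinite_apply] at h1
    exact congrArg Prod.snd h1

/-- An intertwiner of level `U₀` is fixed by `U₀` in the finite component. [folklore] -/
theorem finComponentRep_eq_self_of_mem_level {U₀ : Subgroup (GL (Fin n) (FiniteAdeleRing (𝓞 K) K))}
    {T : multiplicityModule hcpt τ W} (hT : (T : E →L[ℂ] (AdelicGroupData.gl n K).L2 μ) ∈ archIntertwinersLevel hcpt τ W U₀)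
    {u : GL (Fin n) (FiniteAdeleRing (𝓞 K) K)} (hu : u ∈ U₀) : finComponentRep hcpt τ W u T = T :=
  (finComponentRep_apply_eq_self_iff u T).2 fun e => (mem_levelPiece_iff.1 (hT.2 e)).2 u hu

/-- **The finite Whittaker function `y ↦ Λ(y · T)` is left `N_n(K_v)`-equivariant** for a
`ψ_f`-Whittaker functional `Λ` on the finite component. [cite: CogdellAnalyticTheory2004, §1.2] -/
theorem finWhittaker_sndHom_ofLocal_mul {Λ : multiplicityModule hcpt τ W →ₗ[ℂ] ℂ} (hΛ : Λ ∈ finWhittakerFunctionals hcpt τ W)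
    (T : multiplicityModule hcpt τ W) (v : HeightOneSpectrum (𝓞 K)) (u : GL (Fin n) (v.adicCompletion K))
    (hu : u ∈ upperUnitriangular (Fin n) (v.adicCompletion K)) (y : GL (Fin n) (FiniteAdeleRing (𝓞 K) K)) :
    Λ (finComponentRep hcpt τ W (GLn.sndHom n K (GLn.ofLocal n K v u) * y) T) =
      whittakerCharFun ((adeleAddChar K).adicComponent v) ⟨u, hu⟩ * Λ (finComponentRep hcpt τ W y T) := by
  rw [map_mul, Module.End.mul_apply]
  have h := (mem_finWhittakerFunctionals_iff.1 hΛ) ⟨_, sndHom_ofLocal_mem_upperUnitriangular v hu⟩ (finComponentRep hcpt τ W y T)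
  rw [h, ← whittakerCharFun_ofLocal]
  unfold finWhittakerChar
  congr 2
  exact Subtype.ext (GLn.ofFinite_sndHom_ofLocal v u)

/-- **`(H_v, χ_v)`-isotypy of `T` makes `g ↦ Λ(g_f · T)` spread bi-equivariant at `v`.** [folklore] -/
theorem isSpreadWhittakerAt_finWhittaker_of_isotypic (Λ : multiplicityModule hcpt τ W →ₗ[ℂ] ℂ) {T : multiplicityModule hcpt τ W}
    {v : HeightOneSpectrum (𝓞 K)} {t : Fin n → (v.adicCompletion K)ˣ} {M : ℤ} (hM : 0 ≤ M)
    (hψ : ∀ i j : Fin n, (i : ℕ) + 1 = j → ∀ x : v.adicCompletion K, Valued.v x ≤ exp (-M) →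
      (adeleAddChar K).adicComponent v ((t i : v.adicCompletion K) * (t j : v.adicCompletion K)⁻¹ * x) = 1)
    (hiso : ∀ h ∈ spreadLevelGroup t M,
      finComponentRep hcpt τ W (GLn.sndHom n K (GLn.ofLocal n K v h)) T = spreadChar v h • T) :
    IsSpreadWhittakerAt v (adeleAddChar K) t M fun g => Λ (finComponentRep hcpt τ W (GLn.sndHom n K g) T) := by
  refine isSpreadWhittakerAt_of_key hM hψ fun h hh g => ?_
  rw [map_mul, map_mul, Module.End.mul_apply, hiso h hh, LinearMap.map_smul, LinearMap.map_smul, smul_eq_mul]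

end FinWhittaker

/-! ### The `S`-part of one spread pair datum -/

section Datum

variable {n : ℕ} {K : Type} [Field K] [NumberField K]
variable {μ' : Measure (AdelicGroupData.gl (n + 1) K).automorphicQuotient} [(AdelicGroupData.gl (n + 1) K).IsAutomorphicMeasure μ']

attribute [local instance] adelicBorel borelSpace_adelic locallyCompactSpace_adelic secondCountableTopology_gl_adelic
  glAdeleBorel borelSpace_glAdele borelSpace_ideleGroup secondCountableTopology_ideleGroup
  glInfBorel borelSpace_glInf locallyCompactSpace_glInf secondCountableTopology_glInf

attribute [local instance] Literature.MeasureTheory.Group.hasSummableGeomSeries_of_finiteDimensional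
  Literature.MeasureTheory.Group.Units.borelSpace_of_isOpenEmbedding
  Literature.MeasureTheory.Group.Units.secondCountableTopology
  Literature.MeasureTheory.Group.Units.locallyCompactSpace

attribute [local instance] borelSpace_pi_mixedUnits measurableMul_pi_mixedUnits

open ValuativeRel

/-- `1 ∈ 𝕌_K^{n+1}`. [folklore] -/
theorem one_mem_unitBox_univ :
    (1 : Fin (n + 1) → ideleGroup K) ∈ unitBox (n := n + 1) (K := K) (Set.univ : Set (HeightOneSpectrum (𝓞 K))) := by
  rw [unitBox_univ_eq_pi]
  exact Set.mem_univ_pi.2 fun _ => (unitIdeles K).one_mem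

variable [MeasurableSpace (AdeleRing (𝓞 K) K)] [BorelSpace (AdeleRing (𝓞 K) K)]

omit [BorelSpace (AdeleRing (𝓞 K) K)] in
/-- **A product Haar measure charges every neighbourhood of `1` in `(𝔸_Kˣ)ⁿ × K`.** [folklore] -/
theorem prod_measure_ne_zero_of_isOpen_of_one_mem (νA : Measure (Fin (n + 1) → ideleGroup K)) [IsHaarMeasure νA]
    (νK : Measure ↥(maximalCompactAdelic (n + 1) K)) [IsHaarMeasure νK]
    {O : Set ((Fin (n + 1) → ideleGroup K) × ↥(maximalCompactAdelic (n + 1) K))} (hO : IsOpen O) (h1 : (1 : _) ∈ O) :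
    (νA.prod νK) O ≠ 0 := by
  haveI : CompactSpace ↥(maximalCompactAdelic (n + 1) K) :=
    isCompact_iff_compactSpace.1 (isCompact_maximalCompactAdelic (n + 1) K)
  obtain ⟨U, V, hU, hV, h1U, h1V, hUV⟩ := isOpen_prod_iff.1 hO 1 1 h1
  have hpos : (νA.prod νK) (U ×ˢ V) ≠ 0 := by
    rw [Measure.prod_prod]
    exact mul_ne_zero (hU.measure_ne_zero νA ⟨_, h1U⟩) (hV.measure_ne_zero νK ⟨_, h1V⟩)
  exact fun h0 => hpos (measure_mono_null hUV h0)

set_option maxHeartbeats 3000000 in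
set_option synthInstance.maxHeartbeats 200000 in
/-- **The `S`-part of one translated spread pair datum is a non-zero constant times the archimedean
local integral.** Let `π`, `σ̄` be cuspidal with archimedean components `τ`, `τ'`, line data
`(T₀, Λ₀)`, `(T₀', Λ₀')` of their finite Whittaker models (`exists_finWhittaker_transferMap_eq_smul`),
`τ_A = (1, D_f)` a torus element with constant ratios `a`, trivial at the places of the finite set
`S` (`a_v = 1`, `diag(τ_A)_v = 1` for `v ∈ S`), and `(m, 𝔫, T_sp, T₁', η, t, M, c₀)` the spread pair
datum of `exists_spreadPairDatum_neConj` at `S` for `K_∞`-finite Gårding vectors `e`, `e'`, with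
`Λ₀(D_f T_sp) ≠ 0`, `Λ₀'(D_f T₁') ≠ 0`. Then there is `C ≠ 0` such that for every continuous `Φ_∞` and
every `s`

  `∫_{B({v ∉ S}) × K} W_{S_η(T_sp e)}(τ_A ·) W̄_{S_η(T₁' e')}(τ_A ·) Φ(e_{n+1} ·) |det|^s δ⁻¹ d(νA ⊗ νK)
     = C · Ψ_∞(s; W_e, W̄'_{e'}, Φ_∞)`,

`Φ = thinTestFun Φ_∞ S m`, `Ψ_∞ = archRankinSelbergPairIntegral` for `ℓ_∞ = Φ_ℓ(T₀)`, `ℓ'_∞ = Φ_ℓ'(T₀')`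
and the image Haar measures. [cite: JacquetPiatetskiShapiroShalika1983, §2 (2.7) and Prop. 3.3]
[cite: CogdellAnalyticTheory2004, §4.1] -/
theorem exists_const_setIntegral_pair_thin_translate_eq {hcpt : isCompact_glFiniteIntegralLevel (n + 1) K}
    (P Q : CuspidalAutomorphicRepGL (n + 1) K μ')
    {E : Type} [NormedAddCommGroup E] [InnerProductSpace ℂ E] [CompleteSpace E]
    {τ : ContRepresentation ℂ (AutomorphyDatum.gl (n + 1) K hcpt).arch.carrier E} (hτc : τ.IsStronglyContinuous)
    {E' : Type} [NormedAddCommGroup E'] [InnerProductSpace ℂ E'] [CompleteSpace E']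
    {τ' : ContRepresentation ℂ (AutomorphyDatum.gl (n + 1) K hcpt).arch.carrier E'} (hτc' : τ'.IsStronglyContinuous)
    (νA : Measure (Fin (n + 1) → ideleGroup K)) [IsHaarMeasure νA]
    (νK : Measure ↥(maximalCompactAdelic (n + 1) K)) [IsHaarMeasure νK]
    (ν₀ : Measure ↥(adelicUnipotent (n + 1) K)) [IsHaarMeasure ν₀]
    {T₀ : multiplicityModule hcpt τ P.1} {Λ₀ : multiplicityModule hcpt τ P.1 →ₗ[ℂ] ℂ}
    (hΛW : Λ₀ ∈ finWhittakerFunctionals hcpt τ P.1)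
    (hΛ : ∀ T : multiplicityModule hcpt τ P.1,
      transferMap (whittakerFunctional ν₀ (continuous_adeleAddChar K)
        (ContRepresentation.Equiv.refl P.1.toContRep)) hτc T =
        Λ₀ T • transferMap (whittakerFunctional ν₀ (continuous_adeleAddChar K)
          (ContRepresentation.Equiv.refl P.1.toContRep)) hτc T₀)
    {T₀' : multiplicityModule hcpt τ' Q.1} {Λ₀' : multiplicityModule hcpt τ' Q.1 →ₗ[ℂ] ℂ}
    (hΛW' : Λ₀' ∈ finWhittakerFunctionals hcpt τ' Q.1)
    (hΛ' : ∀ T : multiplicityModule hcpt τ' Q.1,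
      transferMap (whittakerFunctional ν₀ (continuous_adeleAddChar K)
        (ContRepresentation.Equiv.refl Q.1.toContRep)) hτc' T =
        Λ₀' T • transferMap (whittakerFunctional ν₀ (continuous_adeleAddChar K)
          (ContRepresentation.Equiv.refl Q.1.toContRep)) hτc' T₀')
    (S : Finset (HeightOneSpectrum (𝓞 K)))
    {τA : Fin (n + 1) → ideleGroup K} {a : ideleGroup K}
    (hratio : ∀ i j : Fin (n + 1), (i : ℕ) + 1 = j → τA i * (τA j)⁻¹ = a)
    (haS : ∀ v ∈ S, ((a : ideleGroup K) : AdeleRing (𝓞 K) K).2 v = 1)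
    (hτS : ∀ v ∈ S, localComponent v (glDiagonal (n + 1) (AdeleRing (𝓞 K) K) τA) = 1)
    (hDmix : GLn.toMixed (n + 1) K (glDiagonal (n + 1) (AdeleRing (𝓞 K) K) τA) = 1)
    {m : ℕ} {𝔫 : Ideal (𝓞 K)} (h𝔫 : 𝔫 ≠ 0) (hS𝔫 : ∀ v : HeightOneSpectrum (𝓞 K), v.asIdeal ∣ 𝔫 → v ∈ S)
    (Tsp : multiplicityModule hcpt τ P.1) (T₁' : multiplicityModule hcpt τ' Q.1)
    {η : GL (Fin (n + 1)) (AdeleRing (𝓞 K) K) → ℝ} (hη : IsTestFunctionGL (n + 1) K η) (hm : 1 ≤ m)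
    (hrad : ∀ v ∈ S, idealRadius K v 𝔫 ≤ exp (-(m : ℤ)))
    (hTsp : (Tsp : E →L[ℂ] (AdelicGroupData.gl (n + 1) K).L2 μ') ∈
      archIntertwinersLevel hcpt τ P.1 (finitePrincipalCongruenceLevel (n + 1) K 𝔫))
    (hT₁' : (T₁' : E' →L[ℂ] (AdelicGroupData.gl (n + 1) K).L2 μ') ∈
      archIntertwinersLevel hcpt τ' Q.1 (finitePrincipalCongruenceLevel (n + 1) K 𝔫))
    (e : archGardingSpace hcpt τ) (e' : archGardingSpace hcpt τ')
    (hfix : smoothedVector P.1 η ⟨(Tsp : E →L[ℂ] (AdelicGroupData.gl (n + 1) K).L2 μ') (e : E),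
        apply_mem_of_mem_multiplicityModule Tsp e⟩ =
      ⟨(Tsp : E →L[ℂ] (AdelicGroupData.gl (n + 1) K).L2 μ') (e : E), apply_mem_of_mem_multiplicityModule Tsp e⟩)
    (hfix' : smoothedVector Q.1 η ⟨(T₁' : E' →L[ℂ] (AdelicGroupData.gl (n + 1) K).L2 μ') (e' : E'),
        apply_mem_of_mem_multiplicityModule T₁' e'⟩ =
      ⟨(T₁' : E' →L[ℂ] (AdelicGroupData.gl (n + 1) K).L2 μ') (e' : E'), apply_mem_of_mem_multiplicityModule T₁' e'⟩)
    {t : ∀ v : HeightOneSpectrum (𝓞 K), Fin (n + 1) → (v.adicCompletion K)ˣ} {M c₀ : HeightOneSpectrum (𝓞 K) → ℤ}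
    (hiso : ∀ v ∈ S, ∀ h ∈ spreadLevelGroup (t v) (M v),
      finComponentRep hcpt τ P.1 (GLn.sndHom (n + 1) K (GLn.ofLocal (n + 1) K v h)) Tsp = spreadChar v h • Tsp)
    (hfixK : ∀ v ∈ S, ∀ k ∈ valuedCongruenceSubgroup (Fin (n + 1)) (exp (-M v)),
      finComponentRep hcpt τ' Q.1 (GLn.sndHom (n + 1) K (GLn.ofLocal (n + 1) K v k)) T₁' = T₁')
    (hpar : ∀ v ∈ S, (∃ x : v.adicCompletion K, Valued.v x ≤ exp (1 - c₀ v) ∧ (adeleAddChar K).adicComponent v x ≠ 1) ∧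
      1 ≤ M v ∧
      (∀ i j : Fin (n + 1), (i : ℕ) + 1 = j → ∀ x : v.adicCompletion K, Valued.v x ≤ exp (-M v) →
        (adeleAddChar K).adicComponent v ((t v i : v.adicCompletion K) * (t v j : v.adicCompletion K)⁻¹ * x) = 1) ∧
      (∀ i j : Fin (n + 1), i ≤ j → Valued.v (t v j : v.adicCompletion K) ≤ Valued.v (t v i : v.adicCompletion K)) ∧
      (∀ i j : Fin (n + 1), (i : ℕ) + 1 = j →
        exp (M v - c₀ v) * Valued.v (t v j : v.adicCompletion K) ≤ Valued.v (t v i : v.adicCompletion K)) ∧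
      exp (-(m : ℤ)) * Valued.v (t v 0 : v.adicCompletion K) ≤
        exp (-M v) * Valued.v (t v (Fin.last n) : v.adicCompletion K))
    (hspread : ∀ v ∈ S, IsSpreadWhittakerAt v (adeleAddChar K) (t v) (M v)
      (whittakerCoeff ν₀ (unipotentTateDomain (n + 1) K) (adeleAddChar K)
        (invQuot (AdelicGroupData.gl (n + 1) K)
          (smoothedForm η ((Tsp : E →L[ℂ] (AdelicGroupData.gl (n + 1) K).L2 μ') (e : E))))))
    (hne : Λ₀ (finComponentRep hcpt τ P.1 (GLn.sndHom (n + 1) K (glDiagonal (n + 1) (AdeleRing (𝓞 K) K) τA)) Tsp) ≠ 0)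
    (hne' : Λ₀' (finComponentRep hcpt τ' Q.1 (GLn.sndHom (n + 1) K (glDiagonal (n + 1) (AdeleRing (𝓞 K) K) τA)) T₁') ≠ 0) :
    ∃ C : ℂ, C ≠ 0 ∧ ∀ {Φinf : (Fin (n + 1) → InfiniteAdeleRing K) → ℝ}, Continuous Φinf → ∀ s : ℂ,
      ∫ p in unitBox {v | v ∉ (↑S : Set (HeightOneSpectrum (𝓞 K)))} ×ˢ Set.univ, torusPairIntegrandC (n + 1) K
          (fun g => whittakerCoeff ν₀ (unipotentTateDomain (n + 1) K) (adeleAddChar K)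
            (invQuot (AdelicGroupData.gl (n + 1) K)
              (smoothedForm η ((Tsp : E →L[ℂ] (AdelicGroupData.gl (n + 1) K).L2 μ') (e : E))))
            (glDiagonal (n + 1) (AdeleRing (𝓞 K) K) τA * g))
          (fun g => star (whittakerCoeff ν₀ (unipotentTateDomain (n + 1) K) (adeleAddChar K)
            (invQuot (AdelicGroupData.gl (n + 1) K)
              (smoothedForm η ((T₁' : E' →L[ℂ] (AdelicGroupData.gl (n + 1) K).L2 μ') (e' : E'))))
            (glDiagonal (n + 1) (AdeleRing (𝓞 K) K) τA * g)))
          (thinTestFun (n + 1) K Φinf S m) s p ∂(νA.prod νK) =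
        C * archRankinSelbergPairIntegral hcpt τ hτc τ' hτc'
          (transferMap (whittakerFunctional ν₀ (continuous_adeleAddChar K)
            (ContRepresentation.Equiv.refl P.1.toContRep)) hτc T₀)
          (transferMap (whittakerFunctional ν₀ (continuous_adeleAddChar K)
            (ContRepresentation.Equiv.refl Q.1.toContRep)) hτc' T₀')
          e e' Φinf
          ((νA.restrict (unitBox (Set.univ : Set (HeightOneSpectrum (𝓞 K))))).map (archTorusOfIdele (n + 1) K))
          (νK.map (kinfOfMaximalCompact (n + 1) K)) s := by
  classical
  haveI := locallyCompactSpace_ideleGroup K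
  haveI hν₀R : ν₀.IsMulRightInvariant := isMulRightInvariant_of_isHaarMeasure_adelicUnipotent ν₀
  -- notation
  set ψ : AddChar (AdeleRing (𝓞 K) K) Circle := adeleAddChar K with hψdef
  set D : GL (Fin (n + 1)) (AdeleRing (𝓞 K) K) := glDiagonal (n + 1) (AdeleRing (𝓞 K) K) τA with hD
  set Df : GL (Fin (n + 1)) (FiniteAdeleRing (𝓞 K) K) := GLn.sndHom (n + 1) K D with hDf
  set ℓ := whittakerFunctional ν₀ (continuous_adeleAddChar K) (ContRepresentation.Equiv.refl P.1.toContRep) with hℓ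
  set ℓ' := whittakerFunctional ν₀ (continuous_adeleAddChar K) (ContRepresentation.Equiv.refl Q.1.toContRep) with hℓ'
  set f : P.1.toSubmodule := ⟨(Tsp : E →L[ℂ] (AdelicGroupData.gl (n + 1) K).L2 μ') (e : E), apply_mem_of_mem_multiplicityModule Tsp e⟩
    with hf
  set f' : Q.1.toSubmodule := ⟨(T₁' : E' →L[ℂ] (AdelicGroupData.gl (n + 1) K).L2 μ') (e' : E'), apply_mem_of_mem_multiplicityModule T₁' e'⟩
    with hf'
  set W : GL (Fin (n + 1)) (AdeleRing (𝓞 K) K) → ℂ := whittakerCoeff ν₀ (unipotentTateDomain (n + 1) K) ψ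
    (invQuot (AdelicGroupData.gl (n + 1) K) (smoothedForm η ((f : P.1.toSubmodule) : (AdelicGroupData.gl (n + 1) K).L2 μ')))
    with hW
  set W' : GL (Fin (n + 1)) (AdeleRing (𝓞 K) K) → ℂ := whittakerCoeff ν₀ (unipotentTateDomain (n + 1) K) ψ
    (invQuot (AdelicGroupData.gl (n + 1) K) (smoothedForm η ((f' : Q.1.toSubmodule) : (AdelicGroupData.gl (n + 1) K).L2 μ')))
    with hW'
  -- the finite and archimedean Whittaker functions and the factorisations
  set w : GL (Fin (n + 1)) (FiniteAdeleRing (𝓞 K) K) → ℂ := fun y => Λ₀ (finComponentRep hcpt τ P.1 y Tsp) with hw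
  set w' : GL (Fin (n + 1)) (FiniteAdeleRing (𝓞 K) K) → ℂ := fun y => Λ₀' (finComponentRep hcpt τ' Q.1 y T₁') with hw'
  set A : GL (Fin (n + 1)) (mixedSpace K) → ℂ := fun h =>
    transferMap ℓ hτc T₀ ⟨τ (toArch hcpt h) (e : E), apply_mem_archGardingSpace hτc _ e.2⟩ with hA
  set A' : GL (Fin (n + 1)) (mixedSpace K) → ℂ := fun h =>
    transferMap ℓ' hτc' T₀' ⟨τ' (toArch hcpt h) (e' : E'), apply_mem_archGardingSpace hτc' _ e'.2⟩ with hA'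
  have hWfac : ∀ g, W g = w (GLn.sndHom (n + 1) K g) * A (GLn.toMixed (n + 1) K g) := fun g =>
    whittakerCoeff_eq_finWhittaker_mul_transferMap P hτc ν₀ hΛ Tsp e hη hfix g
  have hW'fac : ∀ g, W' g = w' (GLn.sndHom (n + 1) K g) * A' (GLn.toMixed (n + 1) K g) := fun g =>
    whittakerCoeff_eq_finWhittaker_mul_transferMap Q hτc' ν₀ hΛ' T₁' e' hη hfix' g
  -- continuity of the archimedean Whittaker functions
  obtain ⟨U₀, hU₀o, hU₀c, hT₀U⟩ := T₀.2
  obtain ⟨U₀', hU₀o', hU₀c', hT₀U'⟩ := T₀'.2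
  have hAc : Continuous A := continuous_transferMap_toArch hcpt hτc hU₀o hU₀c hT₀U ν₀ (continuous_adeleAddChar K) e
  have hA'c : Continuous A' := continuous_transferMap_toArch hcpt hτc' hU₀o' hU₀c' hT₀U' ν₀ (continuous_adeleAddChar K) e'
  -- the finite factor `F` and the archimedean factor `G`
  set F : (Fin (n + 1) → ideleGroup K) × ↥(maximalCompactAdelic (n + 1) K) → ℂ := fun p =>
    w (Df * GLn.sndHom (n + 1) K (torusPoint (n + 1) K p)) * conj (w' (Df * GLn.sndHom (n + 1) K (torusPoint (n + 1) K p))) *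
      thinIndicatorGL (n + 1) K S m (GLn.sndHom (n + 1) K (torusPoint (n + 1) K p)) with hF
  set G : ℂ → ((Fin (n + 1) → InfiniteAdeleRing K) → ℝ) → (Fin (n + 1) → (mixedSpace K)ˣ) × ↥(Kinf (n + 1) K) → ℂ :=
    fun s Φinf z =>
      A (glDiagonal (n + 1) (mixedSpace K) z.1 * (z.2 : GL (Fin (n + 1)) (mixedSpace K))) *
        conj (A' (glDiagonal (n + 1) (mixedSpace K) z.1 * (z.2 : GL (Fin (n + 1)) (mixedSpace K)))) *
        ((Φinf (archLastRow (n + 1) K (glDiagonal (n + 1) (mixedSpace K) z.1 * (z.2 : GL (Fin (n + 1)) (mixedSpace K)))) : ℝ) : ℂ) *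
        archTorusWeightC (n + 1) K s z.1 with hG
  have hGc : ∀ (s : ℂ) {Φinf : (Fin (n + 1) → InfiniteAdeleRing K) → ℝ}, Continuous Φinf → Continuous (G s Φinf) :=
    fun s Φinf hΦ => continuous_archFactor hAc hA'c hΦ s
  -- right invariance of `w`, `w'`, `𝟙_thin` under `K_f(𝔫)`; continuity and measurability of `F`
  have hwU : ∀ u ∈ finitePrincipalCongruenceLevel (n + 1) K 𝔫, ∀ x, w (x * u) = w x := fun u hu x => by
    simp only [hw]
    rw [map_mul, Module.End.mul_apply, finComponentRep_eq_self_of_mem_level hTsp hu]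
  have hw'U : ∀ u ∈ finitePrincipalCongruenceLevel (n + 1) K 𝔫, ∀ x, w' (x * u) = w' x := fun u hu x => by
    simp only [hw']
    rw [map_mul, Module.End.mul_apply, finComponentRep_eq_self_of_mem_level hT₁' hu]
  have hθU : ∀ u ∈ finitePrincipalCongruenceLevel (n + 1) K 𝔫, ∀ x,
      thinIndicatorGL (n + 1) K S m (x * u) = thinIndicatorGL (n + 1) K S m x := fun u hu x =>
    thinIndicatorGL_mul_of_mem_finitePrincipalCongruenceLevel hrad x hu
  have hFc : Continuous F := continuous_finFactor _ (isOpen_finitePrincipalCongruenceLevel (n + 1) K h𝔫) hwU hw'U hθU Df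
  have hFm : Measurable F := hFc.measurable
  have hFarch := fun (y : (Fin (n + 1) → (mixedSpace K)ˣ) × ↥(Kinf (n + 1) K))
      (p : (Fin (n + 1) → ideleGroup K) × ↥(maximalCompactAdelic (n + 1) K)) =>
    finFactor_archLift_mul (w := w) (w' := w') (T := S) (m := m) Df y p
  -- the finite factor is two-valued on the unit box (the support theorem at the places of `S`)
  have hDfS : ∀ v ∈ S, BigHeckeGLn.localComponent (n + 1) K v Df = 1 := fun v hv => by
    rw [hDf, BigHeckeGLn.localComponent_sndHom]; exact hτS v hv
  have hwN : ∀ v ∈ S, ∀ (u : GL (Fin (n + 1)) (v.adicCompletion K)) (hu : u ∈ upperUnitriangular (Fin (n + 1)) (v.adicCompletion K))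
      (y : GL (Fin (n + 1)) (FiniteAdeleRing (𝓞 K) K)),
      w (GLn.sndHom (n + 1) K (GLn.ofLocal (n + 1) K v u) * y) = whittakerCharFun ((adeleAddChar K).adicComponent v) ⟨u, hu⟩ * w y :=
    fun v _ u hu y => finWhittaker_sndHom_ofLocal_mul hΛW Tsp v u hu y
  have hw'N : ∀ v ∈ S, ∀ (u : GL (Fin (n + 1)) (v.adicCompletion K)) (hu : u ∈ upperUnitriangular (Fin (n + 1)) (v.adicCompletion K))
      (y : GL (Fin (n + 1)) (FiniteAdeleRing (𝓞 K) K)),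
      w' (GLn.sndHom (n + 1) K (GLn.ofLocal (n + 1) K v u) * y) = whittakerCharFun ((adeleAddChar K).adicComponent v) ⟨u, hu⟩ * w' y :=
    fun v _ u hu y => finWhittaker_sndHom_ofLocal_mul hΛW' T₁' v u hu y
  have hwS : ∀ v ∈ S, IsSpreadWhittakerAt v (adeleAddChar K) (t v) (M v) (fun g => w (GLn.sndHom (n + 1) K g)) :=
    fun v hv => isSpreadWhittakerAt_finWhittaker_of_isotypic Λ₀ (le_trans zero_le_one (hpar v hv).2.1) (hpar v hv).2.2.1 (hiso v hv)
  have hw'K : ∀ v ∈ S, ∀ k ∈ valuedCongruenceSubgroup (Fin (n + 1)) (exp (-M v)), ∀ y : GL (Fin (n + 1)) (FiniteAdeleRing (𝓞 K) K),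
      w' (y * GLn.sndHom (n + 1) K (GLn.ofLocal (n + 1) K v k)) = w' y := fun v hv k hk y => by
    simp only [hw']
    rw [map_mul, Module.End.mul_apply, hfixK v hv k hk]
  have hF2 : ∀ p : (Fin (n + 1) → ideleGroup K) × ↥(maximalCompactAdelic (n + 1) K),
      p.1 ∈ unitBox (n := n + 1) (K := K) (Set.univ : Set (HeightOneSpectrum (𝓞 K))) → F p = 0 ∨ F p = F 1 := by
    intro p hp
    have h1 : F 1 = w Df * conj (w' Df) := finFactor_one S m Df
    rw [h1]
    exact finFactor_eq_zero_or_eq_apply_one S hwN hw'N hwS (fun v hv => (hpar v hv).1) (fun v hv => (hpar v hv).2.1)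
      (fun v hv => (hpar v hv).2.2.2.1) (fun v hv => (hpar v hv).2.2.2.2.1) (fun v hv => (hpar v hv).2.2.2.2.2) hw'K
      h𝔫 hS𝔫 hwU h𝔫 hS𝔫 hw'U hDfS p hp
  -- the splitting constant
  obtain ⟨cs, hsplit, hcs⟩ := exists_const_setIntegral_unitBox_two_valued_mul_eq νA νK hFm hFarch hF2
  have hF1 : F 1 ≠ 0 := by
    have h1 : F 1 = w Df * conj (w' Df) := finFactor_one S m Df
    rw [h1]
    exact mul_ne_zero hne ((map_ne_zero_iff _ (RingHom.injective _)).2 hne')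
  have hcs0 : cs ≠ 0 := by
    refine hcs (prod_measure_ne_zero_of_isOpen_of_one_mem νA νK
      ((isOpen_unitBox_univ.prod isOpen_univ).inter ((isOpen_compl_singleton (x := (0 : ℂ))).preimage hFc)) ⟨⟨one_mem_unitBox_univ, Set.mem_univ _⟩, hF1⟩)
  -- left `N(𝔸)`-equivariance of the translate for the dilated character, central insensitivity
  set ψ₁ : AddChar (AdeleRing (𝓞 K) K) Circle := ψ.mulShift ((a : ideleGroup K) : AdeleRing (𝓞 K) K) with hψ₁
  have hφinv : IsLeftInvariant (AdelicGroupData.gl (n + 1) K)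
      (invQuot (AdelicGroupData.gl (n + 1) K) (smoothedForm η ((f : P.1.toSubmodule) : (AdelicGroupData.gl (n + 1) K).L2 μ'))) :=
    isLeftInvariant_invQuot _ _
  have hWN : ∀ (u : ↥(adelicUnipotent (n + 1) K)) (g : GL (Fin (n + 1)) (AdeleRing (𝓞 K) K)),
      W ((u : GL (Fin (n + 1)) (AdeleRing (𝓞 K) K)) * g) = whittakerCharFun ψ u * W g := fun u g =>
    whittakerCoeff_unipotent_mul (ν := ν₀) (𝓕 := unipotentTateDomain (n + 1) K) (ψ := ψ)
      (isFundamentalDomain_unipotentTateDomain ν₀) (isGlobalAddChar_adeleAddChar (K := K)) hφinv u g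
  have hWNτ : ∀ (u : ↥(adelicUnipotent (n + 1) K)) (g : GL (Fin (n + 1)) (AdeleRing (𝓞 K) K)),
      (fun g => W (D * g)) ((u : GL (Fin (n + 1)) (AdeleRing (𝓞 K) K)) * g) = whittakerCharFun ψ₁ u * (fun g => W (D * g)) g :=
    fun u g => translate_unipotent_mul_eq hWN τA a hratio u g
  obtain ⟨ω, hωu, -, -, -, -, hω⟩ := P.exists_centralCharacter_smoothedForm
  have hWZτ : ∀ (z : ideleGroup K) (g : GL (Fin (n + 1)) (AdeleRing (𝓞 K) K)),
      ‖(fun g => W (D * g)) (Matrix.GeneralLinearGroup.scalar (Fin (n + 1)) z * g)‖ = ‖(fun g => W (D * g)) g‖ := by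
    intro z g
    change ‖W (D * (Matrix.GeneralLinearGroup.scalar (Fin (n + 1)) z * g))‖ = ‖W (D * g)‖
    rw [← mul_assoc, ← Matrix.GeneralLinearGroup.scalar_commute z D, mul_assoc, hW,
      whittakerCoeff_scalar_mul (fun g => hω η f z g), norm_mul, hωu z, one_mul]
  -- the torus parameters at the places of `S`, for the dilated character
  have hψ₁v : ∀ v ∈ S, ψ₁.adicComponent v = ψ.adicComponent v := fun v hv =>
    adicComponent_mulShift_of_apply_eq_one ψ (haS v hv)
  have hT : ∀ v ∈ S, ∃ (t₁ : Fin (n + 1) → (v.adicCompletion K)ˣ) (M₁ c₁ : ℤ),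
      IsSpreadWhittakerAt v ψ₁ t₁ M₁ (fun g => W (D * g)) ∧
      (∃ x : v.adicCompletion K, Valued.v x ≤ exp (1 - c₁) ∧ ψ₁.adicComponent v x ≠ 1) ∧ 1 ≤ M₁ ∧
      (∀ i j : Fin (n + 1), i ≤ j → Valued.v (t₁ j : v.adicCompletion K) ≤ Valued.v (t₁ i : v.adicCompletion K)) ∧
      (∀ i j : Fin (n + 1), (i : ℕ) + 1 = j →
        exp (M₁ - c₁) * Valued.v (t₁ j : v.adicCompletion K) ≤ Valued.v (t₁ i : v.adicCompletion K)) ∧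
      exp (-(m : ℤ)) * Valued.v (t₁ 0 : v.adicCompletion K) ≤ exp (-M₁) * Valued.v (t₁ (Fin.last n) : v.adicCompletion K) := by
    intro v hv
    obtain ⟨hx, hM1, -, hmono, hgap, hdepth⟩ := hpar v hv
    refine ⟨t v, M v, c₀ v, ((hspread v hv).comp_mul_left D).of_adicComponent_eq (hψ₁v v hv), ?_, hM1, hmono, hgap, hdepth⟩
    rw [hψ₁v v hv]
    exact hx
  -- conclusion
  refine ⟨F 1 * cs, mul_ne_zero hF1 (by exact_mod_cast hcs0), fun {Φinf} hΦ s => ?_⟩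
  -- (a) the thin `S`-integral is the unit-box integral
  rw [setIntegral_torusPairIntegrandC_thin_eq_unitBox_univ (ψ := ψ₁) (W := fun g => W (D * g)) hWNτ hWZτ hm hT
    (fun g => star (W' (D * g))) Φinf s νA νK]
  -- (b) on the unit box the integrand is `F · G`
  have hpt : ∀ p : (Fin (n + 1) → ideleGroup K) × ↥(maximalCompactAdelic (n + 1) K),
      p ∈ unitBox (Set.univ : Set (HeightOneSpectrum (𝓞 K))) ×ˢ (Set.univ : Set ↥(maximalCompactAdelic (n + 1) K)) →
      torusPairIntegrandC (n + 1) K (fun g => W (D * g)) (fun g => star (W' (D * g))) (thinTestFun (n + 1) K Φinf S m) s p =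
        F p * G s Φinf (archTorusOfIdele (n + 1) K p.1, kinfOfMaximalCompact (n + 1) K p.2) := fun p hp =>
    torusPairIntegrandC_translate_thin_eq_finFactor_mul_archFactor hWfac hW'fac hDmix Φinf S m s p hp.1
  rw [setIntegral_congr_fun ((measurableSet_unitBox _).prod MeasurableSet.univ) hpt]
  -- (c) split off the finite factor, (d) the archimedean integral
  rw [hsplit (hGc s hΦ), archRankinSelbergPairIntegral_def]

end Datum

/-! ### The main theorem: all pairs -/

section Main

variable {n : ℕ} {K : Type} [Field K] [NumberField K]
variable {μ' : Measure (AdelicGroupData.gl (n + 1) K).automorphicQuotient} [(AdelicGroupData.gl (n + 1) K).IsAutomorphicMeasure μ']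

attribute [local instance] adelicBorel borelSpace_adelic locallyCompactSpace_adelic secondCountableTopology_gl_adelic
  glAdeleBorel borelSpace_glAdele borelSpace_ideleGroup secondCountableTopology_ideleGroup
  glInfBorel borelSpace_glInf locallyCompactSpace_glInf secondCountableTopology_glInf

attribute [local instance] Literature.MeasureTheory.Group.hasSummableGeomSeries_of_finiteDimensional
  Literature.MeasureTheory.Group.Units.borelSpace_of_isOpenEmbedding
  Literature.MeasureTheory.Group.Units.secondCountableTopology
  Literature.MeasureTheory.Group.Units.locallyCompactSpace

attribute [local instance] borelSpace_pi_mixedUnits measurableMul_pi_mixedUnits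

open ValuativeRel

variable [MeasurableSpace (AdeleRing (𝓞 K) K)] [BorelSpace (AdeleRing (𝓞 K) K)]

set_option maxHeartbeats 4000000 in
set_option synthInstance.maxHeartbeats 200000 in
/-- **Corollaire (i)(b) for ALL pairs from the archimedean local `L`-factor data.** For `n ≥ 1`,
multiplicity one for `GL_{n+1} / K`, ANY number field `K`, cuspidal `π ≠ σ̄` (of arbitrary level)
with Satake families `α`, `β` off a finite set `S`: `L^S(s, π × σ)` agrees on `re s > 1` with an
ENTIRE function — assuming, for every pair of irreducible unitary archimedean components with
non-zero continuous Whittaker functionals and all Haar measures, finitely many `K_∞`-finite Gårding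
test vectors and non-negative continuous Schwartz `Φ_∞` with `Λ(s) Σ_i Ψ_∞(s; e_i, e'_i, Φ_{∞,i}) = 1`
on `re s > 1`, `Λ` entire (the consumed form of Jacquet–Shalika's archimedean theory, supplied by
`archPairLFactorData_of_testVector`). Proof: the torus `τ` of Whittaker shifts off `S`
(`exists_whittakerShiftTorus_outside`); levels supported on `S` with `Φ_ℓ(τ_f T₁) ≠ 0`,
`Φ_ℓ'(τ_f T₁') ≠ 0` (`exists_level_supportedIn_transferMap_translate_ne_zero`); the line data of the
finite Whittaker models (`exists_finWhittaker_transferMap_eq_smul`); the archimedean data of the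
hypothesis for `ℓ_∞ = Φ_ℓ(T₀)`, `ℓ'_∞`; for each datum the spread pair datum at `S`
(`exists_spreadPairDatum_neConj`) whose translated thin `S`-part is `C_i Ψ_∞(s; e_i, e'_i, Φ_{∞,i})`,
`C_i ≠ 0` (`exists_const_setIntegral_pair_thin_translate_eq`); and the per-pair reduction
`exists_entire_eq_partialPairL_of_localData_thin_translate` with coefficients `C_i⁻¹`, `S' = S` and
`B = Λ`. [cite: MoeglinWaldspurger1989, Appendice, Corollaire (i)(b), p. 667]
[cite: JacquetPiatetskiShapiroShalika1983, §2 (2.7), Prop. 3.3, (3.6)] [cite: CogdellAnalyticTheory2004, §4.1–§4.2] -/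
theorem exists_entire_eq_partialPairL_of_archPairLFactorData_allPairs
    (hX : ∀ (hcpt : isCompact_glFiniteIntegralLevel (n + 1) K)
      (E : Type) [NormedAddCommGroup E] [InnerProductSpace ℂ E] [CompleteSpace E]
      (τ : ContRepresentation ℂ (AutomorphyDatum.gl (n + 1) K hcpt).arch.carrier E) (hτ : τ.IsStronglyContinuous)
      (_ : τ.IsUnitary) (_ : τ.IsTopIrreducible)
      (ℓ : archGardingSpace hcpt τ →ₗ[ℂ] ℂ) (_ : IsArchContWhittakerFunctional hcpt τ hτ ℓ) (_ : ℓ ≠ 0)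
      (E' : Type) [NormedAddCommGroup E'] [InnerProductSpace ℂ E'] [CompleteSpace E']
      (τ' : ContRepresentation ℂ (AutomorphyDatum.gl (n + 1) K hcpt).arch.carrier E') (hτ' : τ'.IsStronglyContinuous)
      (_ : τ'.IsUnitary) (_ : τ'.IsTopIrreducible)
      (ℓ' : archGardingSpace hcpt τ' →ₗ[ℂ] ℂ) (_ : IsArchContWhittakerFunctional hcpt τ' hτ' ℓ') (_ : ℓ' ≠ 0)
      [MeasurableSpace (GL (Fin (n + 1)) (mixedSpace K))] [BorelSpace (GL (Fin (n + 1)) (mixedSpace K))]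
      [MeasurableSpace ((mixedSpace K)ˣ)] [BorelSpace ((mixedSpace K)ˣ)]
      (μA : Measure (Fin (n + 1) → (mixedSpace K)ˣ)) (_ : IsHaarMeasure μA)
      (μK : Measure ↥(Kinf (n + 1) K)) (_ : IsHaarMeasure μK),
      ∃ (m : ℕ) (e : Fin m → archGardingSpace hcpt τ) (e' : Fin m → archGardingSpace hcpt τ')
        (_ : ∀ i, FiniteDimensional ℂ (Submodule.span ℂ (Set.range
          fun κ : (AutomorphyDatum.gl (n + 1) K hcpt).arch.maximalCompact => τ (toArch hcpt (κ : GL (Fin (n + 1)) (mixedSpace K))) (e i : E))))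
        (_ : ∀ i, FiniteDimensional ℂ (Submodule.span ℂ (Set.range
          fun κ : (AutomorphyDatum.gl (n + 1) K hcpt).arch.maximalCompact => τ' (toArch hcpt (κ : GL (Fin (n + 1)) (mixedSpace K))) (e' i : E'))))
        (Φinf : Fin m → (Fin (n + 1) → InfiniteAdeleRing K) → ℝ) (_ : ∀ i, Continuous (Φinf i))
        (_ : ∀ i z, 0 ≤ Φinf i z)
        (_ : ∀ i, ∃ Ψ : SchwartzMap (Fin (n + 1) → mixedSpace K) ℂ, ∀ z : Fin (n + 1) → InfiniteAdeleRing K,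
          ((Φinf i z : ℝ) : ℂ) = Ψ fun j => InfiniteAdeleRing.ringEquiv_mixedSpace K (z j))
        (Λ : ℂ → ℂ), Differentiable ℂ Λ ∧ ∀ s : ℂ, 1 < s.re →
          Λ s * ∑ i, archRankinSelbergPairIntegral hcpt τ hτ τ' hτ' ℓ ℓ' (e i) (e' i) (Φinf i) μA μK s = 1)
    (νI : Measure (ideleGroup K)) [νI.IsHaarMeasure]
    (νA : Measure (Fin (n + 1) → ideleGroup K)) [IsHaarMeasure νA]
    (νK : Measure ↥(maximalCompactAdelic (n + 1) K)) [IsHaarMeasure νK]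
    (ν₀ : Measure ↥(adelicUnipotent (n + 1) K)) [IsHaarMeasure ν₀]
    (h₁ : multiplicity_one_gl (n + 1) K μ')
    (P P' : CuspidalAutomorphicRepGL (n + 1) K μ') (hne : P ≠ P'.conj)
    {S : Set (HeightOneSpectrum (𝓞 K))} (hS : S.Finite) {α β : SatakeFamily K}
    (hα : IsSatakeFamilyOf P S α) (hβ : IsSatakeFamilyOf P' S β) :
    ∃ g : ℂ → ℂ, Differentiable ℂ g ∧ ∀ s : ℂ, 1 < s.re → g s = partialPairL S α β s := by
  classical
  have hcpt : isCompact_glFiniteIntegralLevel (n + 1) K := isCompact_glFiniteIntegralLevel_holds (n + 1) K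
  haveI := locallyCompactSpace_ideleGroup K
  have hβc : IsSatakeFamilyOf P'.conj S (fun v => (β v).map conj) := hβ.conj
  -- the finite set of bad places, as a finset
  set Sf : Finset (HeightOneSpectrum (𝓞 K)) := hS.toFinset with hSfdef
  have hSf : ∀ v, v ∈ Sf ↔ v ∈ S := fun v => hS.mem_toFinset
  have hcoe : (↑Sf : Set (HeightOneSpectrum (𝓞 K))) = S := hS.coe_toFinset
  -- (1) the torus of Whittaker shifts off `S`
  obtain ⟨τf, af, hτlast, hratiof, hafS, hτone, hτψ⟩ := exists_whittakerShiftTorus_outside (n + 1) K Sf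
  set τA : Fin (n + 1) → ideleGroup K := fun i =>
    Units.map (MonoidHom.inr (InfiniteAdeleRing K) (FiniteAdeleRing (𝓞 K) K) :
      FiniteAdeleRing (𝓞 K) K →* AdeleRing (𝓞 K) K) (τf i) with hτA
  set a : ideleGroup K := Units.map (MonoidHom.inr (InfiniteAdeleRing K) (FiniteAdeleRing (𝓞 K) K) :
      FiniteAdeleRing (𝓞 K) K →* AdeleRing (𝓞 K) K) af with ha
  have hratio : ∀ i j : Fin (n + 1), (i : ℕ) + 1 = j → τA i * (τA j)⁻¹ = a := fun i j hij => by
    change Units.map _ (τf i) * (Units.map _ (τf j))⁻¹ = Units.map _ af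
    rw [← map_inv, ← map_mul, hratiof i j hij]
  have haS : ∀ v ∈ Sf, ((a : ideleGroup K) : AdeleRing (𝓞 K) K).2 v = 1 := fun v hv => hafS v hv
  set D : GL (Fin (n + 1)) (AdeleRing (𝓞 K) K) := glDiagonal (n + 1) (AdeleRing (𝓞 K) K) τA with hD
  have hDof : D = GLn.ofFinite (n + 1) K (glDiagonal (n + 1) (FiniteAdeleRing (𝓞 K) K) τf) :=
    glDiagonal_unitsMap_inr_eq_ofFinite τf
  have hDmix : GLn.toMixed (n + 1) K D = 1 := by rw [hDof, GLn.toMixed_ofFinite]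
  have hτS : ∀ v ∈ Sf, localComponent v D = 1 := fun v hv => hτone v (Or.inl hv)
  set Df : GL (Fin (n + 1)) (FiniteAdeleRing (𝓞 K) K) := GLn.sndHom (n + 1) K D with hDf
  have hDfS : ∀ v ∈ Sf, BigHeckeGLn.localComponent (n + 1) K v Df = 1 := fun v hv => by
    rw [hDf, BigHeckeGLn.localComponent_sndHom]; exact hτS v hv
  set Splus : Finset (HeightOneSpectrum (𝓞 K)) := Sf ∪ (finite_setOf_dvd_differentIdeal (K := K)).toFinset with hSplus
  have hDfint : ∀ w ∉ Splus, BigHeckeGLn.localComponent (n + 1) K w Df ∈ valuedCongruenceSubgroup (Fin (n + 1)) (1 : ℤᵐ⁰) := by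
    intro w hw
    have h1 : localComponent w D = 1 := hτone w (Or.inr fun h => hw (Finset.mem_union_right _
      ((finite_setOf_dvd_differentIdeal (K := K)).mem_toFinset.2 h)))
    have h2 : BigHeckeGLn.localComponent (n + 1) K w Df = localComponent w D := by
      rw [hDf, BigHeckeGLn.localComponent_sndHom]
      rfl
    rw [h2, h1]
    exact one_mem _
  have hτψS : ∀ v ∉ S, ∃ (d : Fin (n + 1) → (v.adicCompletion K)ˣ) (a : (v.adicCompletion K)ˣ),
      localComponent v (glDiagonal (n + 1) (AdeleRing (𝓞 K) K) τA) = diagonalGL (Fin (n + 1)) (v.adicCompletion K) d ∧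
      (∀ i j : Fin (n + 1), (i : ℕ) + 1 = j →
        (d i : v.adicCompletion K) * ((d j)⁻¹ : (v.adicCompletion K)ˣ) = a) ∧
      (∀ c ∈ 𝒪[v.adicCompletion K], (adeleAddChar K).adicComponent v (a * c) = 1) ∧
      ∀ ϖ : v.adicCompletion K, Valued.v ϖ = WithZero.exp (-1 : ℤ) →
        ∃ c ∈ 𝒪[v.adicCompletion K], (adeleAddChar K).adicComponent v (a * (ϖ⁻¹ * c)) ≠ 1 :=
    fun v hv => hτψ v fun h => hv ((hSf v).1 h)
  -- (2) archimedean components, global Whittaker functionals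
  obtain ⟨E, _, _, _, τ, hτi, hτu, hτc, hex, -⟩ := exists_archComponent_decomposition (hcpt := hcpt) P
  obtain ⟨E', _, _, _, τ', hτi', hτu', hτc', hex', -⟩ := exists_archComponent_decomposition (hcpt := hcpt) P'.conj
  have hℓ : IsContWhittakerFunctional P.1 (adeleAddChar K)
      (whittakerFunctional ν₀ (continuous_adeleAddChar K) (ContRepresentation.Equiv.refl P.1.toContRep)) :=
    isContWhittakerFunctional_whittakerFunctional ν₀ (continuous_adeleAddChar K) (isGlobalAddChar_adeleAddChar K) _
  have hℓ' : IsContWhittakerFunctional P'.conj.1 (adeleAddChar K)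
      (whittakerFunctional ν₀ (continuous_adeleAddChar K) (ContRepresentation.Equiv.refl P'.conj.1.toContRep)) :=
    isContWhittakerFunctional_whittakerFunctional ν₀ (continuous_adeleAddChar K) (isGlobalAddChar_adeleAddChar K) _
  -- (3) levels supported on `S` with non-vanishing transferred functionals at `D_f`
  obtain ⟨𝔫₁, h𝔫₁, hS𝔫₁, T₁, hT₁, hT₁ne⟩ := exists_level_supportedIn_transferMap_translate_ne_zero hcpt (Nat.succ_pos n) P hα
    Sf (fun v hv => (hSf v).2 hv) hτu hτi hτc hex ν₀ τA hτψS
  obtain ⟨𝔫₁', h𝔫₁', hS𝔫₁', T₁', hT₁', hT₁'ne⟩ := exists_level_supportedIn_transferMap_translate_ne_zero hcpt (Nat.succ_pos n)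
    P'.conj hβc Sf (fun v hv => (hSf v).2 hv) hτu' hτi' hτc' hex' ν₀ τA hτψS
  -- (4) the line data of the finite Whittaker models
  have hℓ0 : whittakerFunctional ν₀ (continuous_adeleAddChar K) (ContRepresentation.Equiv.refl P.1.toContRep) ≠ 0 := by
    intro h0
    apply hT₁ne
    refine LinearMap.ext fun v => ?_
    rw [transferMap_apply_apply, h0]
    rfl
  have hℓ0' : whittakerFunctional ν₀ (continuous_adeleAddChar K) (ContRepresentation.Equiv.refl P'.conj.1.toContRep) ≠ 0 := by
    intro h0
    apply hT₁'ne
    refine LinearMap.ext fun v => ?_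
    rw [transferMap_apply_apply, h0]
    rfl
  obtain ⟨T₀, Λ₀, hΛW, -, hℓinf, hΛ⟩ := exists_finWhittaker_transferMap_eq_smul P hτu hτi hτc hex hℓ hℓ0
  obtain ⟨T₀', Λ₀', hΛW', -, hℓinf', hΛ'⟩ := exists_finWhittaker_transferMap_eq_smul P'.conj hτu' hτi' hτc' hex' hℓ' hℓ0'
  have hne₁ : Λ₀ (finComponentRep hcpt τ P.1 Df T₁) ≠ 0 := by
    intro h0
    apply hT₁ne
    rw [hΛ, h0, zero_smul]
  have hne₁' : Λ₀' (finComponentRep hcpt τ' P'.conj.1 Df T₁') ≠ 0 := by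
    intro h0
    apply hT₁'ne
    rw [hΛ', h0, zero_smul]
  -- (5) the archimedean data
  have hℓi : IsArchContWhittakerFunctional hcpt τ hτc
      (transferMap (whittakerFunctional ν₀ (continuous_adeleAddChar K) (ContRepresentation.Equiv.refl P.1.toContRep)) hτc T₀) :=
    transferMap_mem_archContWhittakerFunctionals hℓ hτc _
  have hℓj : IsArchContWhittakerFunctional hcpt τ' hτc'
      (transferMap (whittakerFunctional ν₀ (continuous_adeleAddChar K) (ContRepresentation.Equiv.refl P'.conj.1.toContRep)) hτc' T₀') :=
    transferMap_mem_archContWhittakerFunctionals hℓ' hτc' _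
  obtain ⟨m, e, e', hefin, he'fin, Φinf, hΦc, hΦ0, hΦS, Λ, hΛd, hsum⟩ :=
    hX hcpt E τ hτc hτu hτi _ hℓi hℓinf E' τ' hτc' hτu' hτi' _ hℓj hℓinf'
      ((νA.restrict (unitBox (Set.univ : Set (HeightOneSpectrum (𝓞 K))))).map (archTorusOfIdele (n + 1) K))
      (isHaarMeasure_map_archTorusOfIdele νA) (νK.map (kinfOfMaximalCompact (n + 1) K))
      (isHaarMeasure_map_kinfOfMaximalCompact νK)
  -- (6) per datum: the spread pair datum and its `S`-part
  have hPQ : P.1.toSubmodule ⟂ P'.conj.1.toSubmodule := CuspidalAutomorphicRepGL.isOrtho_of_ne h₁ hne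
  have hdat : ∀ k : Fin m, ∃ (md : ℕ) (𝔫 : Ideal (𝓞 K)) (Tsp : multiplicityModule hcpt τ P.1)
      (η : GL (Fin (n + 1)) (AdeleRing (𝓞 K) K) → ℝ) (C : ℂ),
      𝔫 ≠ 0 ∧ (∀ v : HeightOneSpectrum (𝓞 K), v.asIdeal ∣ 𝔫 → v ∈ Sf) ∧ IsTestFunctionGL (n + 1) K η ∧
      (∀ k' : (AdelicGroupData.gl (n + 1) K).Adelic, k' ∈ principalCongruenceLevel (n + 1) K 𝔫 →
        ∀ g : (AdelicGroupData.gl (n + 1) K).Adelic, η (k' * g) = η g) ∧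
      (T₁' : E' →L[ℂ] (AdelicGroupData.gl (n + 1) K).L2 μ') ∈
        archIntertwinersLevel hcpt τ' P'.conj.1 (finitePrincipalCongruenceLevel (n + 1) K 𝔫) ∧ C ≠ 0 ∧
      ∀ {Φ : (Fin (n + 1) → InfiniteAdeleRing K) → ℝ}, Continuous Φ → ∀ s : ℂ,
        ∫ p in unitBox {v | v ∉ (↑Sf : Set (HeightOneSpectrum (𝓞 K)))} ×ˢ Set.univ, torusPairIntegrandC (n + 1) K
            (fun g => whittakerCoeff ν₀ (unipotentTateDomain (n + 1) K) (adeleAddChar K)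
              (invQuot (AdelicGroupData.gl (n + 1) K)
                (smoothedForm η ((Tsp : E →L[ℂ] (AdelicGroupData.gl (n + 1) K).L2 μ') (e k : E))))
              (glDiagonal (n + 1) (AdeleRing (𝓞 K) K) τA * g))
            (fun g => star (whittakerCoeff ν₀ (unipotentTateDomain (n + 1) K) (adeleAddChar K)
              (invQuot (AdelicGroupData.gl (n + 1) K)
                (smoothedForm η ((T₁' : E' →L[ℂ] (AdelicGroupData.gl (n + 1) K).L2 μ') (e' k : E'))))
              (glDiagonal (n + 1) (AdeleRing (𝓞 K) K) τA * g)))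
            (thinTestFun (n + 1) K Φ Sf md) s p ∂(νA.prod νK) =
          C * archRankinSelbergPairIntegral hcpt τ hτc τ' hτc'
            (transferMap (whittakerFunctional ν₀ (continuous_adeleAddChar K)
              (ContRepresentation.Equiv.refl P.1.toContRep)) hτc T₀)
            (transferMap (whittakerFunctional ν₀ (continuous_adeleAddChar K)
              (ContRepresentation.Equiv.refl P'.conj.1.toContRep)) hτc' T₀')
            (e k) (e' k) Φ
            ((νA.restrict (unitBox (Set.univ : Set (HeightOneSpectrum (𝓞 K))))).map (archTorusOfIdele (n + 1) K))
            (νK.map (kinfOfMaximalCompact (n + 1) K)) s := by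
    intro k
    obtain ⟨md, 𝔫, h𝔫, hS𝔫, Tsp, η, t, M, c₀, hη, hηK, hmd, hrad, hΛeq, hTsp, hT₁'l, hfix, hfix', hiso, hfixK, hpar, hspread⟩ :=
      exists_spreadPairDatum_neConj P P'.conj hPQ hτc ν₀ hℓinf hΛ Sf h𝔫₁ hS𝔫₁ T₁ hT₁ h𝔫₁' hS𝔫₁' T₁' hT₁' Df hDfS
        Splus hDfint (e k) (e' k) (hefin k) (he'fin k)
    have hneD : Λ₀ (finComponentRep hcpt τ P.1 (GLn.sndHom (n + 1) K (glDiagonal (n + 1) (AdeleRing (𝓞 K) K) τA)) Tsp) ≠ 0 := by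
      change Λ₀ (finComponentRep hcpt τ P.1 Df Tsp) ≠ 0
      rw [hΛeq]
      exact hne₁
    obtain ⟨C, hC0, hC⟩ := exists_const_setIntegral_pair_thin_translate_eq P P'.conj hτc hτc' νA νK ν₀ hΛW hΛ hΛW' hΛ' Sf
      hratio haS hτS hDmix h𝔫 hS𝔫 Tsp T₁' hη hmd hrad hTsp hT₁'l (e k) (e' k) hfix hfix' hiso hfixK hpar hspread hneD hne₁'
    exact ⟨md, 𝔫, Tsp, η, C, h𝔫, hS𝔫, hη, hηK, hT₁'l, hC0, fun hΦ s => hC hΦ s⟩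
  choose md 𝔫d Tsp ηd C h𝔫d hS𝔫d hηd hηKd _hT₁'d hC0 hC using hdat
  -- (7) enumerations of the Satake parameters off `S`
  have hxs : ∀ v : HeightOneSpectrum (𝓞 K), ∃ xv : Fin (n + 1) → ℂ, v ∉ S → (Finset.univ : Finset (Fin (n + 1))).val.map xv = α v := by
    intro v
    by_cases hv : v ∈ S
    · exact ⟨0, fun h => (h hv).elim⟩
    · obtain ⟨xv, hxv⟩ := exists_univ_val_map_eq (hα.card_eq hv)
      exact ⟨xv, fun _ => hxv⟩
  have hys : ∀ v : HeightOneSpectrum (𝓞 K), ∃ yv : Fin (n + 1) → ℂ, v ∉ S →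
      (Finset.univ : Finset (Fin (n + 1))).val.map yv = (β v).map conj := by
    intro v
    by_cases hv : v ∈ S
    · exact ⟨0, fun h => (h hv).elim⟩
    · obtain ⟨yv, hyv⟩ := exists_univ_val_map_eq (α := (β v).map conj) (m := n + 1)
        (by rw [Multiset.card_map]; exact hβ.card_eq hv)
      exact ⟨yv, fun _ => hyv⟩
  choose xs hxs' using hxs
  choose ys hys' using hys
  -- (8) the per-pair reduction with thin `S`-parts, `S' = S`, coefficients `C_k⁻¹` and `B = Λ`
  have hS'f : ∀ _ : Fin m, ((↑Sf : Set (HeightOneSpectrum (𝓞 K))) \ S).Finite := fun _ =>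
    (Finset.finite_toSet Sf).subset sdiff_subset
  have hnotin : ∀ {v : HeightOneSpectrum (𝓞 K)}, v ∉ (↑Sf : Set (HeightOneSpectrum (𝓞 K))) ↔ v ∉ S := fun {v} => by
    rw [hcoe]
  refine exists_entire_eq_partialPairL_of_localData_thin_translate νI νA νK ν₀ (Nat.succ_pos n) h₁ P P' hne hα hβ
    (fun k => (C k)⁻¹)
    (fun k => ⟨(Tsp k : E →L[ℂ] (AdelicGroupData.gl (n + 1) K).L2 μ') (e k : E), apply_mem_of_mem_multiplicityModule (Tsp k) (e k)⟩)
    (fun k => ⟨(T₁' : E' →L[ℂ] (AdelicGroupData.gl (n + 1) K).L2 μ') (e' k : E'), apply_mem_of_mem_multiplicityModule T₁' (e' k)⟩)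
    (𝔫₀ := 𝔫d) h𝔫d hηd hηKd (S' := fun _ => (↑Sf : Set (HeightOneSpectrum (𝓞 K)))) hS'f
    (fun _ v hv => by rw [hcoe]; exact hv) (fun k v hv h => hv (Finset.mem_coe.2 (hS𝔫d k v h)))
    (Tth := fun _ => Sf) md (fun _ => subset_rfl) τA hτlast (fun _ v hv => hτψS v (hnotin.1 hv))
    (x := fun _ v => xs v) (y := fun _ v => ys v) (fun _ v hv => hxs' v (hnotin.1 hv)) (fun _ v hv => hys' v (hnotin.1 hv))
    hΦc hΦ0 (fun k => ?_) hΛd fun s hs1 _ => ?_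
  · obtain ⟨Ψ, hΨ⟩ := hΦS k
    exact ofReal_thinTestFun_mem_piSchwartzBruhat hΨ Sf (md k)
  · -- `Λ(s) · Σ_k C_k⁻¹ · (1 · C_k Ψ_∞,k(s)) = Λ(s) Σ_k Ψ_∞,k(s) = 1`
    have htoF : ∀ k : Fin m, (hS'f k).toFinset = ∅ := fun k => by
      rw [Set.Finite.toFinset_eq_empty, Set.sdiff_eq_empty, hcoe]
    refine (congrArg (fun z : ℂ => Λ s * z) (Finset.sum_congr rfl fun k _ => ?_)).trans (hsum s hs1)
    rw [htoF k, Finset.prod_empty, one_mul]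
    erw [hC k (hΦc k) s]
    rw [← mul_assoc, inv_mul_cancel₀ (hC0 k), one_mul]

/-- **Corollaire (i)(b) for ALL pairs from the archimedean test-vector theorem.** For `n ≥ 1`,
multiplicity one for `GL_{n+1} / K`, ANY number field `K`, cuspidal `π ≠ σ̄` with Satake families off a
finite `S`: granted `HumphriesJo2024_archRankinSelberg_testVector (n + 1) K` (Humphries–Jo (2024),
Thm. 1.1), `L^S(s, π × σ)` agrees on `re s > 1` with an entire function.
[cite: MoeglinWaldspurger1989, Appendice, Corollaire (i)(b), p. 667] [cite: HumphriesJo2024, Thm. 1.1] -/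
theorem exists_entire_eq_partialPairL_of_testVector_allPairs (h : HumphriesJo2024_archRankinSelberg_testVector (n + 1) K)
    (νI : Measure (ideleGroup K)) [νI.IsHaarMeasure]
    (νA : Measure (Fin (n + 1) → ideleGroup K)) [IsHaarMeasure νA]
    (νK : Measure ↥(maximalCompactAdelic (n + 1) K)) [IsHaarMeasure νK]
    (ν₀ : Measure ↥(adelicUnipotent (n + 1) K)) [IsHaarMeasure ν₀]
    (h₁ : multiplicity_one_gl (n + 1) K μ')
    (P P' : CuspidalAutomorphicRepGL (n + 1) K μ') (hne : P ≠ P'.conj)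
    {S : Set (HeightOneSpectrum (𝓞 K))} (hS : S.Finite) {α β : SatakeFamily K}
    (hα : IsSatakeFamilyOf P S α) (hβ : IsSatakeFamilyOf P' S β) :
    ∃ g : ℂ → ℂ, Differentiable ℂ g ∧ ∀ s : ℂ, 1 < s.re → g s = partialPairL S α β s :=
  exists_entire_eq_partialPairL_of_archPairLFactorData_allPairs (archPairLFactorData_of_testVector h)
    νI νA νK ν₀ h₁ P P' hne hS hα hβ

end Main

/-! ### The named fact from the archimedean test-vector theorem -/

section Fact

variable {n : ℕ} {K : Type} [Field K] [NumberField K]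
variable {μ' : Measure (AdelicGroupData.gl n K).automorphicQuotient} [(AdelicGroupData.gl n K).IsAutomorphicMeasure μ']

attribute [local instance] adelicBorel borelSpace_adelic locallyCompactSpace_adelic secondCountableTopology_gl_adelic
  glAdeleBorel borelSpace_glAdele

/-- **Mœglin–Waldspurger (1989), Appendice, Corollaire (i)(b), in rank `n` over `K`, for ALL pairs,
from the archimedean test-vector theorem** `HumphriesJo2024_archRankinSelberg_testVector n K`
(Humphries–Jo (2024), Thm. 1.1; equivalently Jacquet–Shalika's archimedean non-vanishing): the named
fact `MoeglinWaldspurger1989_partialPairL_entire_of_ne_conj` (rank `0` is excluded by its hypothesis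
`0 < n`; the Haar measures of the reduction are chosen here).
[cite: MoeglinWaldspurger1989, Appendice, Corollaire (i)(b), p. 667] [cite: HumphriesJo2024, Thm. 1.1]
[cite: JacquetPiatetskiShapiroShalika1983, Prop. 3.3, (3.6)] -/
theorem MoeglinWaldspurger1989_partialPairL_entire_of_ne_conj_of_testVector
    (hX2b : HumphriesJo2024_archRankinSelberg_testVector n K) :
    MoeglinWaldspurger1989_partialPairL_entire_of_ne_conj (n := n) (K := K) (μ := μ') := by
  cases n with
  | zero => intro hn; exact absurd hn (lt_irrefl 0)
  | succ n =>
    intro _ h₁ P P' hne S hS α β hα hβ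
    classical
    -- topological and measurable structures
    haveI : T2Space (GL (Fin (n + 1)) (AdeleRing (𝓞 K) K)) := t2Space_gl (n + 1) K
    haveI : LocallyCompactSpace (GL (Fin (n + 1)) (AdeleRing (𝓞 K) K)) :=
      AdelicGroupData.locallyCompactSpace_generalLinearGroup_adeleRing K (Fin (n + 1))
    haveI := secondCountableTopology_generalLinearGroup_adeleRing K (Fin (n + 1))
    haveI : T2Space (AdeleRing (𝓞 K) K) := t2Space_adeleRing K
    letI : MeasurableSpace (AdeleRing (𝓞 K) K) := borel _
    haveI : BorelSpace (AdeleRing (𝓞 K) K) := ⟨rfl⟩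
    haveI := borelSpace_ideleGroup K
    haveI := locallyCompactSpace_ideleGroup K
    haveI := secondCountableTopology_ideleGroup K
    haveI := secondCountableTopology_adeleRing K
    haveI := locallyCompactSpace_adeleRing' K
    haveI : CompactSpace ↥(maximalCompactAdelic (n + 1) K) :=
      isCompact_iff_compactSpace.1 (isCompact_maximalCompactAdelic (n + 1) K)
    haveI : LocallyCompactSpace ↥(adelicUnipotent (n + 1) K) := (isClosed_adelicUnipotent (n + 1) K).locallyCompactSpace
    haveI : SecondCountableTopology (AdelicGroupData.gl (n + 1) K).Adelic :=
      secondCountableTopology_generalLinearGroup_adeleRing K (Fin (n + 1))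
    haveI : SecondCountableTopology ↥(maximalCompactAdelic (n + 1) K) := TopologicalSpace.Subtype.secondCountableTopology _
    -- Haar measures
    obtain ⟨νI, hνI⟩ := exists_isHaarMeasure_ideleGroup K
    set νA : Measure (Fin (n + 1) → ideleGroup K) := Measure.haar with hνA
    set νK : Measure ↥(maximalCompactAdelic (n + 1) K) := Measure.haar with hνK
    set ν₀ : Measure ↥(adelicUnipotent (n + 1) K) := Measure.haar with hν₀
    exact exists_entire_eq_partialPairL_of_testVector_allPairs hX2b νI νA νK ν₀ h₁ P P' hne hS hα hβ

end Fact

end Literature.NumberTheory.Automorphic
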